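import Summits.HodgeConjecture.CorCM.OcticCurveFourfoldFrameTransfer
import Summits.HodgeConjecture.CorCM.Census.OcticCurveFourfoldParts
import Summits.HodgeConjecture.CorCM.CMWeightDistribution
import HarnessLib

/-!
# COR-CM — `B × E` for an octic CM field `⊇ k` (`k`-signature `(1,3)`): the WEIL PARTS of every product of copies of `B`, `E`
# (the curve used twice) have algebraic lines, GIVEN the Weil plane of the sixfold `(B × E) × E`

Cell `pub-hodgecm2` (COR-CM), seat b30 gen 18 (2026-08-21); count-neutral own lane OCTIC-EB (lit-andre-3's prover-lane ask
A6-R26, generalised to every octic CM field containing `k`).  Theorems + one bookkeeping definition (`slot₃`); no named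
fact, no `sorry`.  Companion of `CorCM/OcticCurveFourfoldWeilSixfold.lean` (the Weil plane of `((B × E) × E, (iδ × δ) × δ)`
is algebraic GIVEN `Markman2025_weilClasses_algebraic_hyperbolicSixfold`); here that plane enters as the HYPOTHESIS `hW₃`,
so nothing in this file depends on a named fact.  Consumed by `CorCM/OcticCurveFourfoldPowersHodgeOfMarkman.lean`.

* §4 `weilClassesOf_biproduct₃_le_algebraicClasses_of_prod` — the Fin-3 analogue of seat b30 gen 14's
  `PairWeights.weilClassesOf_biproduct_le_algebraicClasses_of_prod`: `((A 0 × A 1) × A 2, (f₀ × f₁) × f₂)` versus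
  `(⨁_{m<3} A m, ⊕ f_m)` along the canonical equivariant isomorphism (`map_mem_weilClassesOf_of_comm`,
  `map_mem_algebraicClasses_of_abelianVariety`).
* §5 THE WEIL PARTS.  The Weil generator of the `{B, E}`-slice uses the curve label TWICE, so it is not a weight of
  `Y = B × E`; it IS a weight of the three-slot product `Y₃ = ⨁_{m<3} A₂(slot₃ m) = B ⊞ E ⊞ E` (`slot₃ = (0,1,1)`):
  `weightClassesAlg_three_le_algebraicClasses_of_sgn` (a six-point weight of `Y₃` of constant sign lies in a Weil eigenline,
  `PairWeights.weightClassesAlg_le_weilClassesPlus/Minus`).  **`weightClassesAlg_le_algebraicClasses_of_isWeilPart`**: for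
  ANY slot map `κ : Fin N → Fin 2` and any Weil part `G` of a weight of `X = ⨁_j A₂(κ j)` (`Census/OcticCurveFourfoldParts`:
  two curve points of one sign in two DIFFERENT copies + the four labels of `F` of that sign), `H⁶(X)_G ⊆ N³`: re-slot the
  second curve copy to slot `2` (`κ₃ : Fin N → Fin 3` with `slot₃ ∘ κ₃ = κ`, so that `X` is LITERALLY `⨁_j A₂(slot₃ (κ₃ j))`,
  `weightClassesAlg_le_algebraicClasses_of_isWeilPart_of_factor`), where the part projects injectively onto the Weil weight
  of `Y₃`, and lift with seat b30 gen 15's DISTRIBUTION LEMMA `CMWeights.weightClassesAlg_comp_le_algebraicClasses_of_injOn`.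
HONEST FRAMING: nothing about the Hodge conjecture is concluded here; `HC_CM` is not asserted.
[cite: Deligne1982HodgeCycles, §5 (c)] [cite: vanGeemen1994HodgeAV, 3.6–3.7, 4.9] [cite: Milne2020HodgeClassesAV, 1.2 (a) and Thm. 1]

## References
* [Deligne1982HodgeCycles] P. Deligne (notes by J. S. Milne), LNM 900 (1982), §4 Prop. 4.4, §5 (c).
* [vanGeemen1994HodgeAV] B. van Geemen, LNM 1594 (1994), 3.6–3.7, 4.9 and proof of Thm. 6.12.
* [Milne2020HodgeClassesAV] J. S. Milne, arXiv:2010.08857, 1.2 (a), Thm. 1 (André: CM Hodge classes are sums of pull-backs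
  of Weil classes).
-/

noncomputable section

namespace Summit.HodgeConjecture.CorCM.OcticCurveFourfold

open CategoryTheory CategoryTheory.Limits NumberField
open Literature.AlgebraicGeometry Literature.AlgebraicGeometry.Motives Literature.AlgebraicGeometry.HodgeTheory
open Literature.AlgebraicGeometry.ComplexMultiplication (IsCMTypeRealisation)
open Literature.AlgebraicGeometry.Pohlmann1968
open Literature.AlgebraicTopology.SingularHomology
open Summit.HodgeConjecture.CorCM.Census.OcticCurveFourfold (Pt sgn cj phiPre ModelBalanced IsWeilPart sgn_inl sgn_inr)
open Summit.HodgeConjecture.CorCM.DecicCurveFivefold (curveSlots₂ sigma_cases)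
open Summit.HodgeConjecture.CorCM.PairWeights
open Summit.HodgeConjecture.CorCM.CMWeights (weightClassesAlg_comp_le_algebraicClasses_of_injOn)

/-! ## §4 Three factors: `⨁_{m<3} A m` versus `(A 0 × A 1) × A 2` -/

section ThreeFactors

variable {A : Fin 3 → AbelianVariety ℂ}

/-- The components `(fst ∘ fst, snd ∘ fst, snd)` of the comparison `(A 0 × A 1) × A 2 ⟶ ⨁_{m<3} A m`. [folklore] -/
theorem comparison₃_components_def :
    ∃ c : ∀ m : Fin 3, ((A 0).prod (A 1)).prod (A 2) ⟶ A m,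
      c 0 = AbelianVariety.fst ((A 0).prod (A 1)) (A 2) ≫ AbelianVariety.fst (A 0) (A 1) ∧
      c 1 = AbelianVariety.fst ((A 0).prod (A 1)) (A 2) ≫ AbelianVariety.snd (A 0) (A 1) ∧
      c 2 = AbelianVariety.snd ((A 0).prod (A 1)) (A 2) :=
  ⟨Fin.cons (AbelianVariety.fst ((A 0).prod (A 1)) (A 2) ≫ AbelianVariety.fst (A 0) (A 1))
    (Fin.cons (AbelianVariety.fst ((A 0).prod (A 1)) (A 2) ≫ AbelianVariety.snd (A 0) (A 1))
      (Fin.cons (AbelianVariety.snd ((A 0).prod (A 1)) (A 2)) finZeroElim)), rfl, rfl, rfl⟩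

/-- **The Weil plane of `(⨁_{m<3} A m, ⊕_m f_m)` is algebraic if that of `((A 0 × A 1) × A 2, (f₀ × f₁) × f₂)` is**: pull
back along the equivariant comparison `g = (fst∘fst, snd∘fst, snd)` (`map_mem_weilClassesOf_of_comm`), use the hypothesis,
and pull back along its inverse `((π₀, π₁), π₂)` (`map_mem_algebraicClasses_of_abelianVariety`). The Fin-3 analogue of seat b30
gen 14's `PairWeights.weilClassesOf_biproduct_le_algebraicClasses_of_prod`. [cite: vanGeemen1994HodgeAV, 3.6–3.7] -/
theorem weilClassesOf_biproduct₃_le_algebraicClasses_of_prod (f : ∀ m, A m ⟶ A m) {n d : ℕ}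
    (h : weilClassesOf (((A 0).prod (A 1)).prod (A 2))
        (AbelianVariety.prodLift
          (AbelianVariety.fst ((A 0).prod (A 1)) (A 2) ≫
            AbelianVariety.prodLift (AbelianVariety.fst (A 0) (A 1) ≫ f 0) (AbelianVariety.snd (A 0) (A 1) ≫ f 1))
          (AbelianVariety.snd ((A 0).prod (A 1)) (A 2) ≫ f 2)) n d ≤
      algebraicClasses (((A 0).prod (A 1)).prod (A 2)).X n) :
    weilClassesOf (⨁ A) (biproduct.map f) n d ≤ algebraicClasses (⨁ A).X n := by
  obtain ⟨c, hc0, hc1, hc2⟩ := comparison₃_components_def (A := A)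
  set g : ((A 0).prod (A 1)).prod (A 2) ⟶ ⨁ A := biproduct.lift c with hg_def
  set F : ((A 0).prod (A 1)).prod (A 2) ⟶ ((A 0).prod (A 1)).prod (A 2) := AbelianVariety.prodLift
    (AbelianVariety.fst ((A 0).prod (A 1)) (A 2) ≫
      AbelianVariety.prodLift (AbelianVariety.fst (A 0) (A 1) ≫ f 0) (AbelianVariety.snd (A 0) (A 1) ≫ f 1))
    (AbelianVariety.snd ((A 0).prod (A 1)) (A 2) ≫ f 2) with hF
  set hinv : ⨁ A ⟶ ((A 0).prod (A 1)).prod (A 2) := AbelianVariety.prodLift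
    (AbelianVariety.prodLift (biproduct.π A 0) (biproduct.π A 1)) (biproduct.π A 2) with hhinv
  -- the components of `F ≫ g` and of `g`
  have hFc : ∀ m : Fin 3, F ≫ c m = c m ≫ f m := by
    intro m
    refine Fin.cases ?_ (fun m' => Fin.cases ?_ (fun m'' => Fin.cases ?_ (fun l => l.elim0) m'') m') m
    · rw [hc0, ← Category.assoc, hF, AbelianVariety.prodLift_fst, Category.assoc, AbelianVariety.prodLift_fst,
        Category.assoc]
    · change F ≫ c 1 = c 1 ≫ f 1
      rw [hc1, ← Category.assoc, hF, AbelianVariety.prodLift_fst, Category.assoc, AbelianVariety.prodLift_snd,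
        Category.assoc]
    · change F ≫ c 2 = c 2 ≫ f 2
      rw [hc2, hF, AbelianVariety.prodLift_snd]
  -- equivariance `g ≫ ⊕f = F ≫ g`
  have hcomm : g ≫ biproduct.map f = F ≫ g := by
    refine biproduct.hom_ext _ _ fun m => ?_
    rw [Category.assoc, biproduct.map_π, ← Category.assoc, hg_def, biproduct.lift_π, Category.assoc,
      biproduct.lift_π, hFc]
  -- `hinv ≫ g = 𝟙`
  have hsec : hinv ≫ g = 𝟙 (⨁ A) := by
    refine biproduct.hom_ext _ _ fun m => ?_
    rw [Category.assoc, hg_def, biproduct.lift_π, Category.id_comp]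
    refine Fin.cases ?_ (fun m' => Fin.cases ?_ (fun m'' => Fin.cases ?_ (fun l => l.elim0) m'') m') m
    · rw [hc0, ← Category.assoc, hhinv, AbelianVariety.prodLift_fst, AbelianVariety.prodLift_fst]
    · change hinv ≫ c 1 = biproduct.π A 1
      rw [hc1, ← Category.assoc, hhinv, AbelianVariety.prodLift_fst, AbelianVariety.prodLift_snd]
    · change hinv ≫ c 2 = biproduct.π A 2
      rw [hc2, hhinv, AbelianVariety.prodLift_snd]
  intro x hx
  have hgx := map_mem_weilClassesOf_of_comm (n := n) (d := d) hcomm hx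
  have halg := h hgx
  have h2 := map_mem_algebraicClasses_of_abelianVariety
    (Motives.AbelianVariety.isSmoothProjective_holds (A := ⨁ A)) (((A 0).prod (A 1)).prod (A 2)) hinv.hom.hom.hom halg
  have key : complexBetti.map hinv.hom.hom.hom (2 * n)
      (singularCohomology.map ℂ ℂ (Motives.AlgPoints.mapContinuous (L := ℂ) g.hom.hom.hom) (2 * n) x) = x := by
    change singularCohomology.map ℂ ℂ (Motives.AlgPoints.mapContinuous (L := ℂ) hinv.hom.hom.hom) (2 * n) _ = x
    rw [abelianVarietyHom_map_map_apply, hsec]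
    exact abelianVariety_map_id_apply x
  rw [key] at h2
  exact h2

end ThreeFactors

/-! ## §5 The Weil parts of a product of copies of `B` and `E` have algebraic lines -/

section WeilParts

open scoped Classical

/-- The three-slot fold `(0, 1, 1)`: slots `1` and `2` of `Y₃ = B ⊞ E ⊞ E` are both the curve. [folklore] -/
def slot₃ : Fin 3 → Fin 2 := ![0, 1, 1]

/-- Values of the fold. [folklore] -/
@[simp] theorem slot₃_values : slot₃ 0 = 0 ∧ slot₃ 1 = 1 ∧ slot₃ 2 = 1 := ⟨rfl, rfl, rfl⟩

/-- The fold after the standard embedding `Fin 2 ↪ Fin 3` is the identity. [folklore] -/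
theorem slot₃_castSucc (j : Fin 2) : slot₃ (Fin.castSucc j) = j := by
  fin_cases j <;> rfl

variable {I : Type} {Kf : I → Type} [∀ i, Field (Kf i)] [∀ i, NumberField (Kf i)]
  {i₀ i₁ : I} {e : (Kf i₁ →+* ℂ) ≃ Fin 4 × Bool} {τ : Kf i₀ →+* ℂ} {i : Kf i₀ →+* Kf i₁}
  (hk : ∀ σ : Kf i₀ →+* ℂ, σ = τ ∨ σ = ComplexEmbedding.conjugate τ)
  (he_sign : ∀ s : Kf i₁ →+* ℂ, (e s).2 = true ↔ s.comp i = τ)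
  {A₂ : Fin 2 → AbelianVariety ℂ} {Φ₂ : ∀ j : Fin 2, CMType (Kf (curveSlots₂ i₀ i₁ j))}
  {ι₂ : ∀ j, 𝓞 (Kf (curveSlots₂ i₀ i₁ j)) →+* End (A₂ j)}
  {θ₂ : ∀ j, Kf (curveSlots₂ i₀ i₁ j) →+* Module.End ℂ (complexBetti (A₂ j).X 1)}
  (hA : ∀ j, IsCMTypeRealisation (Φ₂ j) (A₂ j) (ι₂ j) (θ₂ j))
  {δ : 𝓞 (Kf i₀)} {d : ℕ} (hτ : τ (δ : Kf i₀) = Complex.I * (Real.sqrt d : ℂ))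

omit [∀ i, NumberField (Kf i)] in
include hk he_sign hτ in
/-- **Sign ⟹ eigenvalue**: a point of `Hom(F × k, ℂ)` of sign `b` has eigenvalue `+i√d` (`b = true`) resp. `-i√d`
(`b = false`) on the family `a = (iδ, δ)`. [cite: Deligne1982HodgeCycles, §5 (c)] -/
theorem apply_eq_of_sgn (x : (j : Fin 2) × (Kf (curveSlots₂ i₀ i₁ j) →+* ℂ)) (b : Bool)
    (hx : sgn (toPt e τ x) = b) :
    x.2 (((Fin.cons (RingOfIntegers.mapRingHom i δ) (fun _ : Fin 1 => δ) :
        ∀ j : Fin 2, 𝓞 (Kf (curveSlots₂ i₀ i₁ j))) x.1 : 𝓞 (Kf (curveSlots₂ i₀ i₁ x.1))) :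
          Kf (curveSlots₂ i₀ i₁ x.1)) =
      if b then Complex.I * (Real.sqrt d : ℂ) else -(Complex.I * (Real.sqrt d : ℂ)) := by
  have hconjτ : ComplexEmbedding.conjugate τ (δ : Kf i₀) = -(Complex.I * (Real.sqrt d : ℂ)) := by
    rw [ComplexEmbedding.conjugate_coe_eq, hτ, map_mul, Complex.conj_I, Complex.conj_ofReal, neg_mul]
  rcases sigma_cases x with ⟨s, rfl⟩ | ⟨σ, rfl⟩
  · rw [toPt_zero, sgn_inr] at hx
    show s ((RingOfIntegers.mapRingHom i δ : 𝓞 (Kf i₁)) : Kf i₁) = _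
    have hmap : ((RingOfIntegers.mapRingHom i δ : 𝓞 (Kf i₁)) : Kf i₁) = i (δ : Kf i₀) := rfl
    rw [hmap]
    change (s.comp i) (δ : Kf i₀) = _
    cases b
    · rw [if_neg Bool.false_ne_true, comp_eq_conjugate_of_snd_eq_false hk he_sign hx]
      exact hconjτ
    · rw [if_pos rfl, (he_sign s).1 hx]
      exact hτ
  · rw [toPt_one, sgn_inl] at hx
    show σ (δ : Kf i₀) = _
    cases b
    · rw [if_neg Bool.false_ne_true, (hk σ).resolve_left (of_decide_eq_false hx)]
      exact hconjτ
    · rw [if_pos rfl, of_decide_eq_true hx]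
      exact hτ

omit [∀ i, NumberField (Kf i)] in
include hk he_sign hτ in
/-- **A six-point weight of `Y₃ = B ⊞ E ⊞ E` of constant sign has an algebraic line, GIVEN the Weil plane of the sixfold.**
All six points have the same eigenvalue `±i√d` on `a₃ = (iδ, δ, δ)`, so `H⁶(Y₃)_T ⊆ E±(Y₃, ⊕_m ι_m(a₃ m))`
(`PairWeights.weightClassesAlg_le_weilClassesPlus/Minus`) `⊆ W_k(Y₃) ⊗ ℂ`, which is algebraic by the hypothesis `hW₃` on
`((B × E) × E, (iδ × δ) × δ)` transported to `⨁` (`weilClassesOf_biproduct₃_le_algebraicClasses_of_prod`).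
[cite: vanGeemen1994HodgeAV, 4.9 and proof of Thm. 6.12] [cite: Deligne1982HodgeCycles, §5 (c)] -/
theorem weightClassesAlg_three_le_algebraicClasses_of_sgn
    (hW₃ : weilClassesOf (((A₂ 0).prod (A₂ 1)).prod (A₂ 1))
      (AbelianVariety.prodLift
        (AbelianVariety.fst ((A₂ 0).prod (A₂ 1)) (A₂ 1) ≫
          AbelianVariety.prodLift (AbelianVariety.fst (A₂ 0) (A₂ 1) ≫ ι₂ 0 (RingOfIntegers.mapRingHom i δ))
            (AbelianVariety.snd (A₂ 0) (A₂ 1) ≫ ι₂ 1 δ))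
        (AbelianVariety.snd ((A₂ 0).prod (A₂ 1)) (A₂ 1) ≫ ι₂ 1 δ)) 3 d ≤
      algebraicClasses (((A₂ 0).prod (A₂ 1)).prod (A₂ 1)).X 3)
    (b : Bool) (T : Finset ((m : Fin 3) × (Kf (curveSlots₂ i₀ i₁ (slot₃ m)) →+* ℂ))) (hTcard : T.card = 2 * 3)
    (hsgn : ∀ z ∈ T, sgn (toPt e τ ⟨slot₃ z.1, z.2⟩) = b) :
    weightClassesAlg (fun m => A₂ (slot₃ m)) (fun m => ι₂ (slot₃ m)) (2 * 3) T ≤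
      algebraicClasses (⨁ fun m => A₂ (slot₃ m)).X 3 := by
  -- the family `a₃ = (iδ, δ, δ)` on the three slots
  let a₂ : ∀ j : Fin 2, 𝓞 (Kf (curveSlots₂ i₀ i₁ j)) := Fin.cons (RingOfIntegers.mapRingHom i δ) fun _ : Fin 1 => δ
  let a₃ : ∀ m : Fin 3, 𝓞 (Kf (curveSlots₂ i₀ i₁ (slot₃ m))) := fun m => a₂ (slot₃ m)
  have hval : ∀ z ∈ T, z.2 ((a₃ z.1 : 𝓞 (Kf (curveSlots₂ i₀ i₁ (slot₃ z.1)))) : Kf (curveSlots₂ i₀ i₁ (slot₃ z.1))) =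
      if b then Complex.I * (Real.sqrt d : ℂ) else -(Complex.I * (Real.sqrt d : ℂ)) :=
    fun z hz => apply_eq_of_sgn hk he_sign hτ ⟨slot₃ z.1, z.2⟩ b (hsgn z hz)
  -- the Weil plane of `⨁_m A₂(slot₃ m)`, algebraic by `hW₃`
  have hWeil : weilClassesOf (⨁ fun m => A₂ (slot₃ m)) (biproduct.map fun m => ι₂ (slot₃ m) (a₃ m)) 3 d ≤
      algebraicClasses (⨁ fun m => A₂ (slot₃ m)).X 3 :=
    weilClassesOf_biproduct₃_le_algebraicClasses_of_prod (A := fun m => A₂ (slot₃ m))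
      (fun m => ι₂ (slot₃ m) (a₃ m)) hW₃
  cases b
  · refine (weightClassesAlg_le_weilClassesMinus (K := fun m => Kf (curveSlots₂ i₀ i₁ (slot₃ m)))
      (A := fun m => A₂ (slot₃ m)) (ι := fun m => ι₂ (slot₃ m)) a₃ hTcard fun z hz => ?_).trans
      ((weilClassesMinus_le_weilClassesOf _ _ 3 d).trans hWeil)
    simpa using hval z hz
  · refine (weightClassesAlg_le_weilClassesPlus (K := fun m => Kf (curveSlots₂ i₀ i₁ (slot₃ m)))
      (A := fun m => A₂ (slot₃ m)) (ι := fun m => ι₂ (slot₃ m)) a₃ hTcard fun z hz => ?_).trans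
      ((weilClassesPlus_le_weilClassesOf _ _ 3 d).trans hWeil)
    simpa using hval z hz

include hk he_sign hA hτ in
/-- **Re-slotted form.**  For `κ₃ : Fin N → Fin 3`, a Weil part `G` of a weight of `X = ⨁_j A₂(slot₃ (κ₃ j))` on which the
projection `P₃ (j, s) = (κ₃ j, s)` to `Y₃` is injective has an algebraic line: `P₃(G)` is a six-point weight of `Y₃` of
constant sign (`weightClassesAlg_three_le_algebraicClasses_of_sgn`) and the distribution lemma lifts it along `κ₃`.
[cite: Milne2020HodgeClassesAV, 1.2 (a) and Thm. 1] -/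
theorem weightClassesAlg_le_algebraicClasses_of_isWeilPart_three
    (hW₃ : weilClassesOf (((A₂ 0).prod (A₂ 1)).prod (A₂ 1))
      (AbelianVariety.prodLift
        (AbelianVariety.fst ((A₂ 0).prod (A₂ 1)) (A₂ 1) ≫
          AbelianVariety.prodLift (AbelianVariety.fst (A₂ 0) (A₂ 1) ≫ ι₂ 0 (RingOfIntegers.mapRingHom i δ))
            (AbelianVariety.snd (A₂ 0) (A₂ 1) ≫ ι₂ 1 δ))
        (AbelianVariety.snd ((A₂ 0).prod (A₂ 1)) (A₂ 1) ≫ ι₂ 1 δ)) 3 d ≤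
      algebraicClasses (((A₂ 0).prod (A₂ 1)).prod (A₂ 1)).X 3)
    {N : ℕ} (κ₃ : Fin N → Fin 3) {b : Bool} {G : Finset ((j : Fin N) × (Kf (curveSlots₂ i₀ i₁ (slot₃ (κ₃ j))) →+* ℂ))}
    (hG : IsWeilPart (fun x => toPt e τ ⟨slot₃ (κ₃ x.1), x.2⟩) b G)
    (hinj : Set.InjOn (Sigma.map κ₃ (fun _ => id) :
      ((j : Fin N) × (Kf (curveSlots₂ i₀ i₁ (slot₃ (κ₃ j))) →+* ℂ)) →
        ((m : Fin 3) × (Kf (curveSlots₂ i₀ i₁ (slot₃ m)) →+* ℂ))) ↑G) :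
    weightClassesAlg (fun j => A₂ (slot₃ (κ₃ j))) (fun j => ι₂ (slot₃ (κ₃ j))) (2 * 3) G ≤
      algebraicClasses (⨁ fun j => A₂ (slot₃ (κ₃ j))).X 3 := by
  set P₃ : ((j : Fin N) × (Kf (curveSlots₂ i₀ i₁ (slot₃ (κ₃ j))) →+* ℂ)) →
      ((m : Fin 3) × (Kf (curveSlots₂ i₀ i₁ (slot₃ m)) →+* ℂ)) := Sigma.map κ₃ (fun _ => id) with hP₃
  set T := G.image P₃ with hT
  have hTcard : T.card = 2 * 3 := by rw [hT, Finset.card_image_of_injOn hinj, hG.1]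
  have hsgn : ∀ z ∈ T, sgn (toPt e τ ⟨slot₃ z.1, z.2⟩) = b := by
    intro z hz
    obtain ⟨x, hx, rfl⟩ := Finset.mem_image.1 hz
    exact hG.sgn_eq hx
  have hYalg := weightClassesAlg_three_le_algebraicClasses_of_sgn hk he_sign hτ hW₃ b T hTcard hsgn
  exact weightClassesAlg_comp_le_algebraicClasses_of_injOn (K := fun m => Kf (curveSlots₂ i₀ i₁ (slot₃ m)))
    (A := fun m => A₂ (slot₃ m)) (Φ := fun m => Φ₂ (slot₃ m)) (ι := fun m => ι₂ (slot₃ m)) (θ := fun m => θ₂ (slot₃ m))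
    (fun m => hA (slot₃ m)) κ₃ hG.1 hinj hYalg

include hk he_sign hA hτ in
/-- **Re-slotting.**  For `κ : Fin N → Fin 2` FACTORED as `κ = slot₃ ∘ κ₃` (so that `X = ⨁_j A₂(κ j)` is LITERALLY
`⨁_j A₂(slot₃ (κ₃ j))`), a Weil part `G` of a weight of `X` whose curve points are SEPARATED by `κ₃` (distinct curve points
of `G` sit in copies with distinct `κ₃`-slots) has an algebraic line: on `G` the projection to `Y₃` is then injective
(`IsWeilPart.eq_of_inr` for the fourfold points). [cite: Milne2020HodgeClassesAV, 1.2 (a) and Thm. 1] -/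
theorem weightClassesAlg_le_algebraicClasses_of_isWeilPart_of_factor
    (hW₃ : weilClassesOf (((A₂ 0).prod (A₂ 1)).prod (A₂ 1))
      (AbelianVariety.prodLift
        (AbelianVariety.fst ((A₂ 0).prod (A₂ 1)) (A₂ 1) ≫
          AbelianVariety.prodLift (AbelianVariety.fst (A₂ 0) (A₂ 1) ≫ ι₂ 0 (RingOfIntegers.mapRingHom i δ))
            (AbelianVariety.snd (A₂ 0) (A₂ 1) ≫ ι₂ 1 δ))
        (AbelianVariety.snd ((A₂ 0).prod (A₂ 1)) (A₂ 1) ≫ ι₂ 1 δ)) 3 d ≤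
      algebraicClasses (((A₂ 0).prod (A₂ 1)).prod (A₂ 1)).X 3)
    {N : ℕ} (κ : Fin N → Fin 2) (κ₃ : Fin N → Fin 3) (hκ : ∀ j, slot₃ (κ₃ j) = κ j)
    {b : Bool} {G : Finset ((j : Fin N) × (Kf (curveSlots₂ i₀ i₁ (κ j)) →+* ℂ))}
    (hG : IsWeilPart (fun x => toPt e τ ((Sigma.map κ (fun _ => id) :
      ((j : Fin N) × (Kf (curveSlots₂ i₀ i₁ (κ j)) →+* ℂ)) → ((m : Fin 2) × (Kf (curveSlots₂ i₀ i₁ m) →+* ℂ))) x)) b G)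
    (hsep : ∀ x ∈ G, ∀ x' ∈ G, toPt e τ ⟨κ x.1, x.2⟩ = Sum.inl b → toPt e τ ⟨κ x'.1, x'.2⟩ = Sum.inl b → x ≠ x' →
      κ₃ x.1 ≠ κ₃ x'.1) :
    weightClassesAlg (fun j => A₂ (κ j)) (fun j => ι₂ (κ j)) (2 * 3) G ≤ algebraicClasses (⨁ fun j => A₂ (κ j)).X 3 := by
  -- `X` is literally the re-slotted product
  obtain rfl : κ = fun j => slot₃ (κ₃ j) := funext fun j => (hκ j).symm
  refine weightClassesAlg_le_algebraicClasses_of_isWeilPart_three hk he_sign hA hτ hW₃ κ₃ hG ?_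
  -- injectivity of the projection on `G`
  intro x hx x' hx' hxx'
  have hfst : κ₃ x.1 = κ₃ x'.1 := congrArg Sigma.fst hxx'
  have hvv : toPt e τ ⟨slot₃ (κ₃ x.1), x.2⟩ = toPt e τ ⟨slot₃ (κ₃ x'.1), x'.2⟩ := by
    have h := congrArg (fun z : (m : Fin 3) × (Kf (curveSlots₂ i₀ i₁ (slot₃ m)) →+* ℂ) =>
      toPt e τ (⟨slot₃ z.1, z.2⟩ : (m : Fin 2) × (Kf (curveSlots₂ i₀ i₁ m) →+* ℂ))) hxx'
    exact h
  by_contra hne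
  rcases hy : toPt e τ ⟨slot₃ (κ₃ x.1), x.2⟩ with c | q
  · have hc : c = b := by
      have h := hG.sgn_eq hx
      change sgn (toPt e τ ⟨slot₃ (κ₃ x.1), x.2⟩) = b at h
      rw [hy, sgn_inl] at h; exact h
    subst hc
    rw [hy] at hvv
    exact hsep x hx x' hx' hy hvv.symm hne hfst
  · rw [hy] at hvv
    exact hne (hG.eq_of_inr hx hx' hy hvv.symm)

omit [∀ i, NumberField (Kf i)] in
include hk in
/-- A curve point of the index set: `toPt x = inl b` forces the slot to be `1` and the embedding to be `τ` or `τ̄`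
according to `b`. [folklore] -/
theorem fst_eq_one_of_toPt_eq_inl {x : (j : Fin 2) × (Kf (curveSlots₂ i₀ i₁ j) →+* ℂ)} {b : Bool}
    (hx : toPt e τ x = Sum.inl b) :
    ∃ σ : Kf i₀ →+* ℂ, x = ⟨(0 : Fin 1).succ, σ⟩ ∧ σ = if b then τ else ComplexEmbedding.conjugate τ := by
  rcases sigma_cases x with ⟨s, rfl⟩ | ⟨σ, rfl⟩
  · rw [toPt_zero] at hx; exact absurd hx Sum.inr_ne_inl
  · refine ⟨σ, rfl, ?_⟩
    rw [toPt_one, Sum.inl.injEq] at hx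
    cases b
    · rw [if_neg Bool.false_ne_true]; exact (hk σ).resolve_left (of_decide_eq_false hx)
    · rw [if_pos rfl]; exact of_decide_eq_true hx

include hk he_sign hA hτ in
/-- **THE WEIL PARTS HAVE ALGEBRAIC LINES (any slot map).**  For `κ : Fin N → Fin 2` and a Weil part `G` (sign `b`) of a weight
of `X = ⨁_j A₂(κ j)` — two curve points `x₁ ≠ x₂` over `inl b`, necessarily in two different copies `j₁ ≠ j₂` of `E`, and
the four labels of `F` of sign `b` — `H⁶(X)_G ⊆ N³ H⁶(X)`, GIVEN the Weil plane of the sixfold `(B × E) × E`.  Re-slot: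
`κ₃ j₂ = 2`, `κ₃ j = κ j ↪ Fin 3` otherwise (`slot₃ ∘ κ₃ = κ`, and `κ₃ j₁ = 1 ≠ 2 = κ₃ j₂` separates the two curve points),
then `weightClassesAlg_le_algebraicClasses_of_isWeilPart_of_factor`.
[cite: Milne2020HodgeClassesAV, 1.2 (a) and Thm. 1] [cite: Deligne1982HodgeCycles, §5 (c)] -/
theorem weightClassesAlg_le_algebraicClasses_of_isWeilPart
    (hW₃ : weilClassesOf (((A₂ 0).prod (A₂ 1)).prod (A₂ 1))
      (AbelianVariety.prodLift
        (AbelianVariety.fst ((A₂ 0).prod (A₂ 1)) (A₂ 1) ≫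
          AbelianVariety.prodLift (AbelianVariety.fst (A₂ 0) (A₂ 1) ≫ ι₂ 0 (RingOfIntegers.mapRingHom i δ))
            (AbelianVariety.snd (A₂ 0) (A₂ 1) ≫ ι₂ 1 δ))
        (AbelianVariety.snd ((A₂ 0).prod (A₂ 1)) (A₂ 1) ≫ ι₂ 1 δ)) 3 d ≤
      algebraicClasses (((A₂ 0).prod (A₂ 1)).prod (A₂ 1)).X 3)
    {N : ℕ} (κ : Fin N → Fin 2) {b : Bool} {G : Finset ((j : Fin N) × (Kf (curveSlots₂ i₀ i₁ (κ j)) →+* ℂ))}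
    (hG : IsWeilPart (fun x => toPt e τ ((Sigma.map κ (fun _ => id) :
      ((j : Fin N) × (Kf (curveSlots₂ i₀ i₁ (κ j)) →+* ℂ)) → ((m : Fin 2) × (Kf (curveSlots₂ i₀ i₁ m) →+* ℂ))) x)) b G) :
    weightClassesAlg (fun j => A₂ (κ j)) (fun j => ι₂ (κ j)) (2 * 3) G ≤ algebraicClasses (⨁ fun j => A₂ (κ j)).X 3 := by
  -- the two curve points, in two different copies
  obtain ⟨x₁, hx₁, x₂, hx₂, hne, hv₁, hv₂⟩ := hG.exists_pair
  obtain ⟨σ₁, hσ₁, hσ₁'⟩ := fst_eq_one_of_toPt_eq_inl hk (x := ⟨κ x₁.1, x₁.2⟩) hv₁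
  obtain ⟨σ₂, hσ₂, hσ₂'⟩ := fst_eq_one_of_toPt_eq_inl hk (x := ⟨κ x₂.1, x₂.2⟩) hv₂
  have hκ₁ : κ x₁.1 = (0 : Fin 1).succ := congrArg Sigma.fst hσ₁
  have hκ₂ : κ x₂.1 = (0 : Fin 1).succ := congrArg Sigma.fst hσ₂
  have hj : x₁.1 ≠ x₂.1 := by
    intro hj
    apply hne
    have h1 : (⟨κ x₁.1, x₁.2⟩ : (m : Fin 2) × (Kf (curveSlots₂ i₀ i₁ m) →+* ℂ)) = ⟨κ x₂.1, x₂.2⟩ := by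
      rw [hσ₁, hσ₂, hσ₁', hσ₂']
    obtain ⟨j₁, s₁⟩ := x₁
    obtain ⟨j₂, s₂⟩ := x₂
    change j₁ = j₂ at hj
    subst hj
    simp only [Sigma.mk.injEq, heq_eq_eq, true_and] at h1 ⊢
    exact h1
  -- the curve points of `G` are exactly `x₁`, `x₂`
  have hmem : ∀ y ∈ G, toPt e τ ⟨κ y.1, y.2⟩ = Sum.inl b → y = x₁ ∨ y = x₂ := by
    intro y hy' hyv
    obtain ⟨z₁, z₂, -, h12⟩ := Finset.card_eq_two.1 hG.2.1
    have hall : ∀ y ∈ G, toPt e τ ⟨κ y.1, y.2⟩ = Sum.inl b → y = z₁ ∨ y = z₂ := by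
      intro y hy'' hyv'
      have : y ∈ G.filter fun x => toPt e τ ((Sigma.map κ (fun _ => id) :
          ((j : Fin N) × (Kf (curveSlots₂ i₀ i₁ (κ j)) →+* ℂ)) → ((m : Fin 2) × (Kf (curveSlots₂ i₀ i₁ m) →+* ℂ))) x) =
            Sum.inl b := Finset.mem_filter.2 ⟨hy'', hyv'⟩
      rw [h12, Finset.mem_insert, Finset.mem_singleton] at this
      exact this
    rcases hall x₁ hx₁ hv₁ with h₁ | h₁ <;> rcases hall x₂ hx₂ hv₂ with h₂ | h₂
    · exact absurd (h₁.trans h₂.symm) hne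
    · rcases hall y hy' hyv with h | h
      · exact Or.inl (h.trans h₁.symm)
      · exact Or.inr (h.trans h₂.symm)
    · rcases hall y hy' hyv with h | h
      · exact Or.inr (h.trans h₂.symm)
      · exact Or.inl (h.trans h₁.symm)
    · exact absurd (h₁.trans h₂.symm) hne
  -- the re-slotting
  let κ₃ : Fin N → Fin 3 := fun j => if j = x₂.1 then 2 else Fin.castSucc (κ j)
  have hκ₃ : ∀ j, slot₃ (κ₃ j) = κ j := by
    intro j
    by_cases h : j = x₂.1
    · simp only [κ₃, if_pos h]; rw [h, hκ₂]; rfl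
    · simp only [κ₃, if_neg h]; exact slot₃_castSucc (κ j)
  have hκ₃₂ : κ₃ x₂.1 = 2 := by simp only [κ₃, if_pos rfl]
  have hκ₃₁ : κ₃ x₁.1 = 1 := by simp only [κ₃, if_neg hj]; rw [hκ₁]; rfl
  refine weightClassesAlg_le_algebraicClasses_of_isWeilPart_of_factor hk he_sign hA hτ hW₃ κ κ₃ hκ₃ hG ?_
  intro x hx x' hx' hxv hx'v hxx' hfst
  rcases hmem x hx hxv with rfl | rfl <;> rcases hmem x' hx' hx'v with rfl | rfl
  · exact hxx' rfl
  · rw [hκ₃₁, hκ₃₂] at hfst; exact absurd hfst (by decide)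
  · rw [hκ₃₁, hκ₃₂] at hfst; exact absurd hfst (by decide)
  · exact hxx' rfl

end WeilParts

end Summit.HodgeConjecture.CorCM.OcticCurveFourfold

end
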